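import Summits.BirchSwinnertonDyer.BirchSwinnertonDyer.Theorems.PrintCFramJZeroThreeUnitRegimeValuePsiBernoulli
import HarnessLib

/-! # K12r@3 — the «3-unit regime» at `p = 3`, BERNOULLI LAYER for an ODD quadratic `ψ` given by an
# integer value function (`ψ₀ = ψε_K`): `ψ₀⁻¹ε_K = ψ⁻¹↑`, `ψ₀ω⁻¹ = ((ψ↑χ_r↑)↑ω⁻¹↑)↑`, the two
# certificates `3 ∤ Σ_{j<f} v(j)j` and `3 ∥ Σ_{j<3fr} v(j)(j/r)(j/3)j`, and the binder `hB`
# (cell `bsd-print-cfram`, seat p3 g2; regime N = `TorsionFreeFrameBSDThree`, stmt-BirchSwinnertonDyer-20698;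
# serves `χ₋₄` [432b 3888p/s/t] and `(·/7)` [1323m 11907r/s/t])

HONEST FRAMING (cell `bsd-print-cfram`, run/shared/lean/pub/bsd-print-cfram/, D-0131 (2) print
tier; verbatim in every file of the cell): the cell works the partition leaf
`CornerF ∧ p ramified in the CM field K` (LADDER-BSD row K7r = B13; W-ALL row 12r) in PARTITION
currency — a leaf or a cell counts only when its theorem is in the kernel BY NAME. Nothing here is a
Literature statement, no named fact is introduced, nothing is asserted about BSD; beyond-print: NO
(Dirichlet-character bookkeeping; the odd-`ψ` half of `…UnitRegimeValuePsiBernoulli`, after bsd-cm's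
`RouteUKroneckerPsi.bernoulliCharOne_psiK/Two_psiK` at `p = 7`).

* §1 `not_even_of_odd`; `bernoulliCharOne_of_odd` (`= ψ⁻¹↑`), `bernoulliCharTwo_of_odd` (`= θ₂'↑`,
  `θ₂' = (ψ↑·ε↑)↑·ω⁻¹↑` of level `f·r·p`) — any `p ≠ 2`.
* §2 `θ₂'` for `ε = χ_r` at `p = 3`: values `v(j)(j/r)(j/3)` exactly, PRIMITIVE (`f`, `r`, `3` pairwise
  coprime), `≠ 1`, `‖B_{1,θ₂'}‖₃ = 1 ⟸ 3 ∥ S₂'` (bsd-cm's certificate, exponent `0`).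
* §3 **`bernoulli_hypothesis_three_of_odd_values`** — `hB` of `JZeroThree.bsdp_three_of_thm120_unitRegime`
  for `ε_K = χ_r↑` from `3 ∤ Σ_{j<f} v(j)j` (`‖B_{1,ψ⁻¹}‖₃ = 1`, level `f` prime to `3`) and `3 ∥ S₂'`
  (bsd-cm `RouteU.bernoulli_hypothesis_of_certs`).
References: [KrizLi2019] §1.5 (1) (p. 7, `ψ₀`), Thm. 1.20 (p. 8), §2 (pp. 11–12); [Washington1997]
Ch. 3, §5.1, Thm. 4.2; `X12/O11/RouteUKroneckerPsi.lean`, `RouteUBernoulliCertificate.lean` (bsd-cm).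
-/

set_option linter.dupNamespace false
set_option autoImplicit false

noncomputable section

open scoped Classical
open NumberField DirichletCharacter Literature.NumberTheory.EllipticCurves.KrizLi2019
  Literature.NumberTheory.LFunctions
  Summit.BirchSwinnertonDyer.Rank1Residual.X12.O11.RouteU

namespace Summit.BirchSwinnertonDyer.BirchSwinnertonDyer.Theorems.PrintCFram

/-! ## §1–§2 `ψ` odd: `ψ₀ = ψε_K`, `ψ₀⁻¹ε_K = ψ⁻¹↑`, `ψ₀ω⁻¹ = (ψ↑χ_r↑)↑·ω⁻¹↑` -/

section Odd

variable {p : ℕ} [hp : Fact p.Prime] {f D r : ℕ}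

/-- In `ℚ_p` (`p ≠ 2`) an odd character is not even. [cite: Washington1997, Ch. 3] -/
theorem not_even_of_odd (hp2 : p ≠ 2) (ψ : DirichletCharacter ℚ_[p] f) (hodd : ψ.Odd) : ¬ ψ.Even := by
  intro hev
  have h : (1 : ℚ_[p]) = -1 := hev.symm.trans hodd
  have h2 : (2 : ℚ_[p]) = 0 := by linear_combination h
  have hn : ‖((2 : ℕ) : ℚ_[p])‖ = 1 :=
    Padic.norm_natCast_eq_one_iff.mpr ((Nat.coprime_primes hp.out Nat.prime_two).mpr hp2)
  rw [Nat.cast_ofNat, h2, norm_zero] at hn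
  exact zero_ne_one hn

/-- **`ψ₀⁻¹ε_K = ψ⁻¹↑` for `ψ` ODD** (`ψ₀ = ψε_K`, `ε_K² `-free: `(ψε_K)⁻¹ε_K = ψ⁻¹`), at level
`f·D`. [cite: KrizLi2019, §1.5 (p. 7, ψ₀) and Thm. 1.20 (p. 8)] -/
theorem bernoulliCharOne_of_odd (hp2 : p ≠ 2) (ψ : DirichletCharacter ℚ_[p] f) (hodd : ψ.Odd)
    (εK : DirichletCharacter ℚ_[p] D) :
    bernoulliCharOne ψ εK = changeLevel (dvd_mul_right f D) ψ⁻¹ := by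
  unfold bernoulliCharOne evenTwist
  rw [if_neg (not_even_of_odd hp2 ψ hodd), mul_inv, mul_assoc, inv_mul_cancel, mul_one, map_inv]

/-- **`ψ₀ω⁻¹ = θ₂'↑` for `ψ` ODD and `ε_K = ε↑`** (`ε` of level `r ∣ D`), where
`θ₂' := (ψ↑·ε↑)↑·ω⁻¹↑` has level `f·r·p`. [cite: KrizLi2019, §1.5 (p. 7, ψ₀) and Thm. 1.20 (p. 8)] -/
theorem bernoulliCharTwo_of_odd (hp2 : p ≠ 2) (ψ : DirichletCharacter ℚ_[p] f) (hodd : ψ.Odd)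
    (ε : DirichletCharacter ℚ_[p] r) (hr : r ∣ D) (ω : DirichletCharacter ℚ_[p] p) :
    bernoulliCharTwo ψ (changeLevel hr ε) ω =
      changeLevel (mul_dvd_mul_right (mul_dvd_mul_left f hr) p)
        (changeLevel (dvd_mul_right (f * r) p)
          (changeLevel (dvd_mul_right f r) ψ * changeLevel (dvd_mul_left r f) ε) *
          changeLevel (dvd_mul_left p (f * r)) ω⁻¹) := by
  unfold bernoulliCharTwo evenTwist
  rw [if_neg (not_even_of_odd hp2 ψ hodd)]
  simp only [map_mul, ← changeLevel_trans]

end Odd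

section ThetaTwoOdd

variable {f r : ℕ} [hf : NeZero f] [hr : Fact r.Prime]
  (ψ : DirichletCharacter ℚ_[3] f) (v : ℕ → ℤ) (χr : DirichletCharacter ℚ_[3] r)
  (ω : DirichletCharacter ℚ_[3] 3)
  (hv : ∀ a : ℕ, ψ (a : ZMod f) = ((v a : ℤ) : ℚ_[3]))
  (hχr : ∀ a : ℕ, χr (a : ZMod r) = (legendreSym r (a : ℤ) : ℚ_[3]))
  (hω : IsTeichmullerCharacter ω)

include hv hχr hω

/-- Values of `θ₂' = (ψ↑·χ_r↑)↑·ω⁻¹↑` at level `f·r·3`: `θ₂'(j) = v(j)(j/r)(j/3)` EXACTLY.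
[cite: KrizLi2019, §2 (p. 11)] -/
theorem thetaTwoOdd_apply (j : ZMod (f * r * 3)) :
    (changeLevel (dvd_mul_right (f * r) 3)
        (changeLevel (dvd_mul_right f r) ψ * changeLevel (dvd_mul_left r f) χr) *
      changeLevel (dvd_mul_left 3 (f * r)) ω⁻¹ : DirichletCharacter ℚ_[3] (f * r * 3)) j =
      ((v j.val * jacobiSym (j.val : ℤ) r * jacobiSym (j.val : ℤ) 3 : ℤ) : ℚ_[3]) := by
  haveI : NeZero (f * r) := ⟨mul_ne_zero hf.out hr.out.ne_zero⟩
  haveI : NeZero (f * r * 3) := ⟨mul_ne_zero (mul_ne_zero hf.out hr.out.ne_zero) (by norm_num)⟩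
  have hj : ((j.val : ℤ) : ZMod (f * r * 3)) = j := by rw [Int.cast_natCast, ZMod.natCast_zmod_val]
  rw [teichmuller_three_inv_eq hω]
  by_cases hu : IsCoprime (j.val : ℤ) ((f * r * 3 : ℕ) : ℤ)
  · have hu' : IsCoprime (j.val : ℤ) ((f * r : ℕ) : ℤ) := by
      rw [Nat.isCoprime_iff_coprime] at hu ⊢; exact Nat.Coprime.coprime_mul_right_right hu
    conv_lhs => rw [← hj]
    rw [MulChar.mul_apply, changeLevel_eq_cast_of_dvd' _ _ hu, changeLevel_eq_cast_of_dvd' _ _ hu,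
      MulChar.mul_apply, changeLevel_eq_cast_of_dvd' _ _ hu', changeLevel_eq_cast_of_dvd' _ _ hu',
      Int.cast_natCast, Int.cast_natCast, Int.cast_natCast, hv, hχr,
      teichmuller_three_apply_eq_legendreSym hω, jacobiSym.legendreSym.to_jacobiSym,
      jacobiSym.legendreSym.to_jacobiSym, Int.cast_mul, Int.cast_mul]
  · have hnu : ¬ IsUnit j := by
      rw [← hj, ZMod.coe_int_isUnit_iff_isCoprime]; exact fun h => hu (by simpa [isCoprime_comm] using h)
    rw [MulChar.map_nonunit _ hnu]
    have hc : ¬ (j.val).Coprime (f * r * 3) := fun h => hu (Nat.isCoprime_iff_coprime.mpr h)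
    rw [Nat.coprime_mul_iff_right, Nat.coprime_mul_iff_right, not_and_or, not_and_or] at hc
    rcases hc with (h1 | h1) | h1
    · rw [val_eq_zero_of_not_coprime ψ v hv h1]; simp
    · have hd : r ∣ j.val := by
        rwa [Nat.coprime_comm, Nat.Prime.coprime_iff_not_dvd hr.out, not_not] at h1
      rw [← jacobiSym.legendreSym.to_jacobiSym r (j.val : ℤ),
        (legendreSym.eq_zero_iff r _).mpr (by rw [Int.cast_natCast]; exact (ZMod.natCast_eq_zero_iff _ _).mpr hd)]
      simp
    · have hd : 3 ∣ j.val := by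
        rwa [Nat.coprime_comm, Nat.Prime.coprime_iff_not_dvd Nat.prime_three, not_not] at h1
      rw [← jacobiSym.legendreSym.to_jacobiSym 3 (j.val : ℤ),
        (legendreSym.eq_zero_iff 3 _).mpr (by rw [Int.cast_natCast]; exact (ZMod.natCast_eq_zero_iff _ _).mpr hd)]
      simp

omit hv in
/-- **`θ₂'` is PRIMITIVE of conductor `f·r·3`** (`ψ` primitive; `f`, `r`, `3` pairwise coprime,
`r` an odd prime). [cite: Washington1997, Ch. 3] -/
theorem thetaTwoOdd_isPrimitive (hψp : ψ.IsPrimitive) (hfr : f.Coprime r) (hf3 : f.Coprime 3)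
    (hr2 : r ≠ 2) (hr3 : r ≠ 3) :
    (changeLevel (dvd_mul_right (f * r) 3)
        (changeLevel (dvd_mul_right f r) ψ * changeLevel (dvd_mul_left r f) χr) *
      changeLevel (dvd_mul_left 3 (f * r)) ω⁻¹ : DirichletCharacter ℚ_[3] (f * r * 3)).IsPrimitive := by
  haveI : NeZero (f * r) := ⟨mul_ne_zero hf.out hr.out.ne_zero⟩
  haveI : NeZero (f * r * 3) := ⟨mul_ne_zero (mul_ne_zero hf.out hr.out.ne_zero) (by norm_num)⟩
  have hcf : ψ.conductor = f := hψp
  have hcr : χr.conductor = r :=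
    conductor_eq_of_prime_of_ne_one χr (legendreChar_three_ne_one χr hχr hr2)
  have hc3 : ω⁻¹.conductor = 3 := by
    rw [conductor_inv]
    exact conductor_eq_of_prime_of_ne_one ω (ne_one_of_isTeichmullerCharacter (by norm_num) hω)
  have hinner : (changeLevel (dvd_mul_right f r) ψ * changeLevel (dvd_mul_left r f) χr :
      DirichletCharacter ℚ_[3] (f * r)).conductor = f * r := by
    rw [conductor_changeLevel_mul_changeLevel _ _ ψ χr (by rwa [hcf, hcr]), hcf, hcr]
  have hcop : (f * r).Coprime 3 :=
    Nat.Coprime.mul_left hf3 ((Nat.coprime_primes hr.out Nat.prime_three).mpr hr3)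
  rw [isPrimitive_def, conductor_changeLevel_mul_changeLevel _ _ _ ω⁻¹ (by rwa [hinner, hc3]),
    hinner, hc3]

omit hv in
/-- `θ₂' ≠ 1`. [cite: Washington1997, Ch. 3] -/
theorem thetaTwoOdd_ne_one (hψp : ψ.IsPrimitive) (hfr : f.Coprime r) (hf3 : f.Coprime 3)
    (hr2 : r ≠ 2) (hr3 : r ≠ 3) :
    (changeLevel (dvd_mul_right (f * r) 3)
        (changeLevel (dvd_mul_right f r) ψ * changeLevel (dvd_mul_left r f) χr) *
      changeLevel (dvd_mul_left 3 (f * r)) ω⁻¹ : DirichletCharacter ℚ_[3] (f * r * 3)) ≠ 1 := by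
  haveI : NeZero (f * r * 3) := ⟨mul_ne_zero (mul_ne_zero hf.out hr.out.ne_zero) (by norm_num)⟩
  intro h1
  have hc := (eq_one_iff_conductor_eq_one).mp h1
  rw [(isPrimitive_def _).mp (thetaTwoOdd_isPrimitive ψ χr ω hχr hω hψp hfr hf3 hr2 hr3)] at hc
  exact absurd (Nat.eq_one_of_mul_eq_one_left hc) (by norm_num)

/-- **CERTIFICATE 2 (odd `ψ`): `‖B_{1,θ₂'}‖₃ = 1` from `3 ∥ S₂' = Σ_{j<3fr} v(j)(j/r)(j/3)·j`**.
[cite: KrizLi2019, Thm. 1.20 (p. 8) and §1.5 (1)] [cite: Washington1997, Thm. 4.2] -/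
theorem norm_generalizedBernoulli_thetaTwoOdd (hψp : ψ.IsPrimitive) (hfr : f.Coprime r)
    (hf3 : f.Coprime 3) (hr2 : r ≠ 2) (hr3 : r ≠ 3)
    (hS : (3 : ℤ) ∣ ∑ j ∈ Finset.range (f * r * 3),
      v j * jacobiSym (j : ℤ) r * jacobiSym (j : ℤ) 3 * (j : ℤ) ^ (0 + 1))
    (hS' : ¬ ((3 : ℤ) ^ 2 ∣ ∑ j ∈ Finset.range (f * r * 3),
      v j * jacobiSym (j : ℤ) r * jacobiSym (j : ℤ) 3 * (j : ℤ) ^ (0 + 1))) :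
    ‖generalizedBernoulli 1 (changeLevel (dvd_mul_right (f * r) 3)
        (changeLevel (dvd_mul_right f r) ψ * changeLevel (dvd_mul_left r f) χr) *
      changeLevel (dvd_mul_left 3 (f * r)) ω⁻¹ : DirichletCharacter ℚ_[3] (f * r * 3))‖ = 1 := by
  haveI : NeZero (f * r * 3) := ⟨mul_ne_zero (mul_ne_zero hf.out hr.out.ne_zero) (by norm_num)⟩
  have hcop : (f * r).Coprime 3 :=
    Nat.Coprime.mul_left hf3 ((Nat.coprime_primes hr.out Nat.prime_three).mpr hr3)
  have h3 : ¬ 3 ∣ f * r := fun h => by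
    have := Nat.Coprime.eq_one_of_dvd (Nat.Coprime.symm hcop) h; norm_num at this
  have hval : padicValNat 3 (f * r * 3) = 1 := by
    rw [padicValNat.mul (mul_ne_zero hf.out hr.out.ne_zero) (by norm_num),
      padicValNat.eq_zero_of_not_dvd h3, padicValNat_self]
  refine norm_generalizedBernoulli_one_eq_one_of_cert _
    (thetaTwoOdd_ne_one ψ χr ω hχr hω hψp hfr hf3 hr2 hr3) hval
    (fun j => v j.val * jacobiSym (j.val : ℤ) r * jacobiSym (j.val : ℤ) 3) 0 (fun j => ?_) ?_ ?_
  · rw [thetaTwoOdd_apply ψ v χr ω hv hχr hω j, pow_zero, mul_one, sub_self, norm_zero]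
    positivity
  · rwa [sum_univ_zmod_eq_sum_range
      (fun j => v j * jacobiSym (j : ℤ) r * jacobiSym (j : ℤ) 3 * (j : ℤ) ^ (0 + 1))]
  · rwa [sum_univ_zmod_eq_sum_range
      (fun j => v j * jacobiSym (j : ℤ) r * jacobiSym (j : ℤ) 3 * (j : ℤ) ^ (0 + 1))]

end ThetaTwoOdd

/-! ## §3 `hB` from the two certificates (`ψ` odd) -/

section Assembly

variable {f r D : ℕ} [hf : NeZero f] [hr : Fact r.Prime] [NeZero D]
  (ψ : DirichletCharacter ℚ_[3] f) (v : ℕ → ℤ) (χr : DirichletCharacter ℚ_[3] r)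
  (ω : DirichletCharacter ℚ_[3] 3)
  (hv : ∀ a : ℕ, ψ (a : ZMod f) = ((v a : ℤ) : ℚ_[3])) (hψ2 : ψ * ψ = 1) (hψp : ψ.IsPrimitive)
  (hχr : ∀ a : ℕ, χr (a : ZMod r) = (legendreSym r (a : ℤ) : ℚ_[3]))
  (hω : IsTeichmullerCharacter ω)
  (hfr : f.Coprime r) (hf3 : f.Coprime 3) (hr2 : r ≠ 2) (hr3 : r ≠ 3) (h : r ∣ D)

include hv hψ2 hψp hχr hω hfr hf3 hr2 hr3

/-- **`hB` for an ODD value-`ψ` and `ε_K = χ_r↑`** (`ψ₀ = ψε_K`), modulo the two integer certificates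
`3 ∤ S₁' = Σ_{j<f} v(j)j` (`θ₁ = ψ⁻¹`, level `f` prime to `3`) and `3 ∥ S₂' = Σ_{j<3fr} v(j)(j/r)(j/3)j`.
[cite: KrizLi2019, Thm. 1.20 (p. 8, the Bernoulli hypothesis) and §1.5 (p. 7, ψ₀)] -/
theorem bernoulli_hypothesis_three_of_odd_values (hodd : ψ.Odd)
    (hS₁ : ¬ ((3 : ℤ) ∣ ∑ j ∈ Finset.range f, v j * (j : ℤ)))
    (hS₂ : (3 : ℤ) ∣ ∑ j ∈ Finset.range (f * r * 3),
      v j * jacobiSym (j : ℤ) r * jacobiSym (j : ℤ) 3 * (j : ℤ) ^ (0 + 1))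
    (hS₂' : ¬ ((3 : ℤ) ^ 2 ∣ ∑ j ∈ Finset.range (f * r * 3),
      v j * jacobiSym (j : ℤ) r * jacobiSym (j : ℤ) 3 * (j : ℤ) ^ (0 + 1))) :
    ¬ (‖bernoulliOnePrim (bernoulliCharOne ψ (changeLevel h χr)) *
        bernoulliOnePrim (bernoulliCharTwo ψ (changeLevel h χr) ω)‖ ≤ ((3 : ℕ) : ℝ)⁻¹) := by
  haveI : NeZero (f * r * 3) := ⟨mul_ne_zero (mul_ne_zero hf.out hr.out.ne_zero) (by norm_num)⟩
  have hf3' : ¬ 3 ∣ f := fun hd => by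
    have := Nat.Coprime.eq_one_of_dvd (Nat.Coprime.symm hf3) hd; norm_num at this
  have hf1 : f ≠ 1 := by
    rintro rfl
    -- a character mod `1` is even (`-1 = 1` in `ZMod 1`)
    exact not_even_of_odd (p := 3) (by norm_num) ψ hodd (by
      show ψ (-1) = 1
      rw [show (-1 : ZMod 1) = 1 from Subsingleton.elim _ _, map_one])
  -- `θ₁ = ψ⁻¹`: primitive, `≠ 1`, `‖B_{1,ψ⁻¹}‖₃ = 1`
  have hθ₁ : ψ⁻¹.IsPrimitive := by rw [isPrimitive_def, conductor_inv]; exact hψp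
  have hne : ψ⁻¹ ≠ 1 := fun h1 => by
    have hc := (eq_one_iff_conductor_eq_one).mp h1
    rw [(isPrimitive_def _).mp hθ₁] at hc
    exact hf1 hc
  have hu₁ : ‖generalizedBernoulli 1 ψ⁻¹‖ = 1 := by
    refine norm_generalizedBernoulli_one_eq_one_of_intCert ψ⁻¹ hne hf3' (fun j => v j.val)
      (fun j => inv_apply_eq_val ψ v hv hψ2 j) ?_
    rwa [sum_univ_zmod_eq_sum_range (fun j => v j * (j : ℤ))]
  exact bernoulli_hypothesis_of_certs ψ⁻¹ hθ₁ (dvd_mul_right f D) _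
    (thetaTwoOdd_isPrimitive ψ χr ω hχr hω hψp hfr hf3 hr2 hr3)
    (mul_dvd_mul_right (mul_dvd_mul_left f h) 3)
    _ (bernoulliCharOne_of_odd (by norm_num) ψ hodd (changeLevel h χr))
    _ (bernoulliCharTwo_of_odd (by norm_num) ψ hodd χr h ω) hu₁
    (norm_generalizedBernoulli_thetaTwoOdd ψ v χr ω hv hχr hω hψp hfr hf3 hr2 hr3 hS₂ hS₂')

end Assembly

end Summit.BirchSwinnertonDyer.BirchSwinnertonDyer.Theorems.PrintCFram

end
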